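import Mathlib
import HarnessLib
import Summits.Ventures.LatticeQCDFlow.Scoring.ChainIncrementFutureDecorrelation
import Summits.Ventures.LatticeQCDFlow.Scoring.GeometricEnvelopeBlockSumMoments

/-!
# Two increments against the future decay in BOTH gaps, and the squared block martingale
# decorrelates from every later centred observable: `|E_{μ₀}[M_{s,n}² ḡ(X_{s+n+m})]| ≤ c ρ^m/(1−ρ)`,
# uniformly in `n`, under a geometric sup-norm envelope

HONEST FRAMING: exact (Metropolis-corrected) sampling algorithms for lattice gauge theory;
figures of merit are autocorrelation/cost numbers at stated couplings and volumes; no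
continuum-physics claim.

Venture `LatticeQCDFlow` (cell pub-lqcd), topic `Scoring`; FANOUT row 8 (`s0-cpn-nemc`, GEN-21).
NEW WORK of the cell, not a published result; no definition is introduced; nothing is cited as a
fact.  Notation of `Scoring/ChainMartingaleIncrements.lean` / `Scoring/ChainIncrementFutureDecorrelation.lean`
(`|h| ≤ C_h`, `D_b = h(X_{b+1}) − kop κ h(X_b)`, `M_{s,n} = Σ_{t<n} D_{s+t}`, envelope
`|(kop κ)^[t] g − πg| ≤ 2 C_g A ρ^t`).  (i) TWO GAPS: for `b₂ = b₁ + 1 + m'` and `|g| ≤ C_g`,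
`|E[D_{b₁} D_{b₂} g(X_{b₂+1+m})]| ≤ 16 C_h² C_g A² ρ^m ρ^{m'}` — condition on time `b₂` (the increment
lemma with the past functional `D_{b₁}` leaves `E[D_{b₁} c_φ(X_{b₂})]`, `|c_φ| ≤ 4 C_h C_g A ρ^m`), then
on time `b₁` (the increment lemma again, now with the observable `c_φ` at distance `m'`).
(ii) THE SQUARED MARTINGALE AGAINST THE FUTURE: for `π`-centred `|ḡ| ≤ C_g`, by induction on `n` with
`M_{n+1}² = M_n² + 2 M_n D_n + D_n²`: the diagonal term is `≤ 8 C_h² C_g A ρ^m` (tower + centred decay),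
the cross term `≤ 2 Σ_{i<n} 16 C_h² C_g A² ρ^m ρ^{n−1−i} ≤ 32 C_h² C_g A² ρ^m/(1−ρ)` by (i), so
`|E_{μ₀}[M_{s,n}² ḡ(X_{s+n+m})]| ≤ c ρ^m/(1−ρ)` with `c = 8 C_h² C_g A + 32 C_h² C_g A²/(1−ρ)`, for EVERY
`n` and every start — the squared martingale, of size `n`, sees a later centred observable only
through an `O(1)` window.  At `m = 0` with `ḡ = q − πq` (`q` the conditional variance of the
increment) this is the step `E[M_n² D_n²] = πq · E[M_n²] + O(1)` of the fourth-moment recursion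
(`Scoring/BlockMartingaleFourthMomentLeading.lean`).  Printed counterpart NAMED ONLY: fourth-order
cumulant / mixing bounds for uniformly ergodic chains (Ibragimov 1962; Meyn–Tweedie 1993 Ch. 17),
nothing cited as a fact.

## Content (envelope `(A, ρ)`, `0 ≤ A`, `0 ≤ ρ < 1`; `P_{μ₀}` the path law from ANY `μ₀`)

* **`abs_chain_increment_increment_future_le_of_envelope`** —
  `|E[D_{b} D_{b+1+m'} g(X_{b+1+m'+1+m})]| ≤ 16 C_h² C_g A² ρ^m ρ^{m'}`;
* `abs_chain_incrementSq_future_le_of_envelope` — `πḡ = 0` ⇒ `|E[G D_b² ḡ(X_{b+1+m})]| ≤ …`-type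
  diagonal bound `|E[D_b² ḡ(X_{b+1+m})]| ≤ 8 C_h² C_g A ρ^m`;
* **`abs_chain_blockMartingale_sq_mul_future_le_of_envelope`** — `πḡ = 0` ⇒ for all `n, m`:
  `|E_{μ₀}[M_{s,n}² ḡ(X_{s+n+m})]| ≤ (8 C_h² C_g A + 32 C_h² C_g A²/(1−ρ)) ρ^m/(1−ρ)`.

NOT CLAIMED: sharp constants; unbounded observables; anything about a concrete sampler.
-/

noncomputable section

namespace Summit.Ventures.LatticeQCDFlow.Scoring

open MeasureTheory ProbabilityTheory Filter Finset Preorder Literature.Probability.MarkovChains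
open scoped ENNReal Topology

variable {Ω : Type*} [MeasurableSpace Ω]

section Envelope

variable {κ : Kernel Ω Ω} [IsMarkovKernel κ] {π : Measure Ω} {A ρ : ℝ}
  (μ₀ : Measure Ω) [IsProbabilityMeasure μ₀]

/-- **TWO INCREMENTS AGAINST THE FUTURE DECAY IN BOTH GAPS.**  Envelope `(A, ρ)` (`0 ≤ A`, `0 ≤ ρ`),
`|h| ≤ C_h`, `|g| ≤ C_g` measurable; for all `b, m', m`:
`|E_{μ₀}[D_b · D_{b+1+m'} · g(X_{b+1+m'+1+m})]| ≤ 16 C_h² C_g A² ρ^m ρ^{m'}`. -/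
theorem abs_chain_increment_increment_future_le_of_envelope
    (henv : ∀ (g : Ω → ℝ), Measurable g → ∀ (Cg : ℝ), (∀ x, |g x| ≤ Cg) →
      ∀ (t : ℕ) (x : Ω), |(kop κ)^[t] g x - ∫ y, g y ∂π| ≤ 2 * Cg * (A * ρ ^ t))
    (b m' m : ℕ) {h : Ω → ℝ} (hh : Measurable h) {Ch : ℝ} (hCh : ∀ x, |h x| ≤ Ch)
    {g : Ω → ℝ} (hg : Measurable g) {Cg : ℝ} (hCg : ∀ x, |g x| ≤ Cg) :
    |∫ x, (h (x (b + 1)) - kop κ h (x b))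
        * (h (x (b + 1 + m' + 1)) - kop κ h (x (b + 1 + m'))) * g (x (b + 1 + m' + 1 + m))
        ∂(Kernel.trajMeasure (X := fun _ : ℕ => Ω) μ₀
          (fun n : ℕ => κ.comap (fun h : (i : ↥(Finset.Iic n)) → Ω => h ⟨n, Finset.mem_Iic.2 le_rfl⟩)
            (measurable_pi_apply _)))|
      ≤ 16 * Ch ^ 2 * Cg * A ^ 2 * ρ ^ m * ρ ^ m' := by
  set P := Kernel.trajMeasure (X := fun _ : ℕ => Ω) μ₀
      (fun n : ℕ => κ.comap (fun h : (i : ↥(Finset.Iic n)) → Ω => h ⟨n, Finset.mem_Iic.2 le_rfl⟩)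
        (measurable_pi_apply _)) with hP
  have hCh0 : 0 ≤ Ch := (abs_nonneg _).trans (hCh (Classical.choice
    (nonempty_of_isProbabilityMeasure μ₀)))
  -- the earlier increment as a past functional at time `b + 1 + m'`
  set G : (ℕ → Ω) → ℝ := fun x => h (x (b + 1)) - kop κ h (x b) with hGdef
  have hGm : Measurable G :=
    (hh.comp (measurable_pi_apply _)).sub ((measurable_kop κ hh).comp (measurable_pi_apply _))
  have hGd : DependsOn G (Set.Iic (b + 1 + m')) := by
    intro x y hxy
    show h (x (b + 1)) - kop κ h (x b) = h (y (b + 1)) - kop κ h (y b)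
    rw [hxy (b + 1) (Set.mem_Iic.2 (Nat.le_add_right _ _)), hxy b (Set.mem_Iic.2 (by omega))]
  have hGb : ∀ x, |G x| ≤ 2 * Ch := fun x =>
    (abs_sub _ _).trans (by linarith [hCh (x (b + 1)), abs_kop_le κ hCh (x b)])
  -- step 1: condition on time `b + 1 + m'`
  obtain ⟨hKm, hKb⟩ := iterate_kop_bounded_measurable κ hg hCg m
  have h1 := chain_increment_mul_future κ μ₀ (b + 1 + m') m hGm hGd hGb hh hCh hg hCg
  have h2 := chain_increment_mul_next κ μ₀ (b + 1 + m') hGm hGd hGb hh hCh hKm hKb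
  rw [← hP] at h1 h2
  set δ : ℝ := 2 * Cg * (A * ρ ^ m) with hδ
  have hRb : ∀ y, |(kop κ)^[m] g y - ∫ z, g z ∂π| ≤ δ := fun y => henv g hg Cg hCg m y
  set cφ : Ω → ℝ := fun y => kop κ (fun z => h z * (kop κ)^[m] g z) y
    - kop κ h y * kop κ ((kop κ)^[m] g) y with hcφ
  have hcb : ∀ y, |cφ y| ≤ 2 * Ch * δ := fun y => abs_kopCov_le κ hh hCh hKm hKb hRb y
  have hcm : Measurable cφ := (kopCov_bounded_measurable κ hh hCh hKm hKb).1
  -- step 2: condition on time `b` (the increment lemma with the trivial past functional)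
  have h3 := abs_chain_increment_mul_future_le_of_envelope (μ₀ := μ₀) henv b m'
    (G := fun _ => (1 : ℝ)) measurable_const ((dependsOn_const (1 : ℝ)).mono (Set.empty_subset _))
    (CG := 1) (fun _ => by simp) hh hCh hcm hcb
  rw [← hP] at h3
  simp only [one_mul, abs_one, integral_const, probReal_univ, smul_eq_mul, mul_one] at h3
  have hEq : ∫ x, G x * (h (x (b + 1 + m' + 1)) - kop κ h (x (b + 1 + m'))) * g (x (b + 1 + m' + 1 + m)) ∂P
      = ∫ x, (h (x (b + 1)) - kop κ h (x b)) * cφ (x (b + 1 + m')) ∂P := by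
    rw [h1, h2]
  show |∫ x, G x * (h (x (b + 1 + m' + 1)) - kop κ h (x (b + 1 + m'))) * g (x (b + 1 + m' + 1 + m)) ∂P|
    ≤ 16 * Ch ^ 2 * Cg * A ^ 2 * ρ ^ m * ρ ^ m'
  rw [hEq]
  refine h3.trans (le_of_eq ?_)
  rw [hδ]; ring

/-- **The squared increment against a later centred observable**: `πḡ = 0`, `|ḡ| ≤ C_g` ⇒
`|E_{μ₀}[D_b² ḡ(X_{b+1+m})]| ≤ 8 C_h² C_g A ρ^m`. -/
theorem abs_chain_incrementSq_future_le_of_envelope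
    (henv : ∀ (g : Ω → ℝ), Measurable g → ∀ (Cg : ℝ), (∀ x, |g x| ≤ Cg) →
      ∀ (t : ℕ) (x : Ω), |(kop κ)^[t] g x - ∫ y, g y ∂π| ≤ 2 * Cg * (A * ρ ^ t))
    (b m : ℕ) {h : Ω → ℝ} (hh : Measurable h) {Ch : ℝ} (hCh : ∀ x, |h x| ≤ Ch)
    {g : Ω → ℝ} (hg : Measurable g) {Cg : ℝ} (hCg : ∀ x, |g x| ≤ Cg) (hg0 : ∫ y, g y ∂π = 0) :
    |∫ x, (h (x (b + 1)) - kop κ h (x b)) ^ 2 * g (x (b + 1 + m))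
        ∂(Kernel.trajMeasure (X := fun _ : ℕ => Ω) μ₀
          (fun n : ℕ => κ.comap (fun h : (i : ↥(Finset.Iic n)) → Ω => h ⟨n, Finset.mem_Iic.2 le_rfl⟩)
            (measurable_pi_apply _)))|
      ≤ 8 * Ch ^ 2 * Cg * A * ρ ^ m := by
  set P := Kernel.trajMeasure (X := fun _ : ℕ => Ω) μ₀
      (fun n : ℕ => κ.comap (fun h : (i : ↥(Finset.Iic n)) → Ω => h ⟨n, Finset.mem_Iic.2 le_rfl⟩)
        (measurable_pi_apply _)) with hP
  have hCh0 : 0 ≤ Ch := (abs_nonneg _).trans (hCh (Classical.choice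
    (nonempty_of_isProbabilityMeasure μ₀)))
  have hCg0 : 0 ≤ Cg := (abs_nonneg _).trans (hCg (Classical.choice
    (nonempty_of_isProbabilityMeasure μ₀)))
  set G : (ℕ → Ω) → ℝ := fun x => (h (x (b + 1)) - kop κ h (x b)) ^ 2 with hGdef
  have hGm : Measurable G :=
    ((hh.comp (measurable_pi_apply _)).sub ((measurable_kop κ hh).comp (measurable_pi_apply _))).pow_const 2
  have hGd : DependsOn G (Set.Iic (b + 1)) := by
    intro x y hxy
    show (h (x (b + 1)) - kop κ h (x b)) ^ 2 = (h (y (b + 1)) - kop κ h (y b)) ^ 2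
    rw [hxy (b + 1) (Set.mem_Iic.2 le_rfl), hxy b (Set.mem_Iic.2 (Nat.le_succ b))]
  have hDb : ∀ x : ℕ → Ω, |h (x (b + 1)) - kop κ h (x b)| ≤ 2 * Ch := fun x =>
    (abs_sub _ _).trans (by linarith [hCh (x (b + 1)), abs_kop_le κ hCh (x b)])
  have hGb : ∀ x, |G x| ≤ (2 * Ch) ^ 2 := fun x => by
    show |(h (x (b + 1)) - kop κ h (x b)) ^ 2| ≤ (2 * Ch) ^ 2
    rw [abs_pow]; exact pow_le_pow_left₀ (abs_nonneg _) (hDb x) 2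
  obtain ⟨hKm, hKb⟩ := iterate_kop_bounded_measurable κ hg hCg m
  have hdec : ∀ y, |(kop κ)^[m] g y| ≤ 2 * Cg * (A * ρ ^ m) :=
    decay_of_geometricEnvelope henv g hg Cg hCg hg0 m
  have h1 := chain_tower_iterate_dependsOn κ μ₀ (b + 1) m hGm hGd hGb hg hCg
  rw [← hP] at h1
  show |∫ x, G x * g (x (b + 1 + m)) ∂P| ≤ 8 * Ch ^ 2 * Cg * A * ρ ^ m
  rw [h1]
  have hiB : Integrable (fun x : ℕ → Ω => (2 * Ch) ^ 2 * (2 * Cg * (A * ρ ^ m))) P := integrable_const _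
  calc |∫ x, G x * (kop κ)^[m] g (x (b + 1)) ∂P| = ‖∫ x, G x * (kop κ)^[m] g (x (b + 1)) ∂P‖ :=
        (Real.norm_eq_abs _).symm
    _ ≤ ∫ x, ‖G x * (kop κ)^[m] g (x (b + 1))‖ ∂P := norm_integral_le_integral_norm _
    _ ≤ ∫ x, (2 * Ch) ^ 2 * (2 * Cg * (A * ρ ^ m)) ∂P := by
        refine integral_mono_of_nonneg (ae_of_all _ fun x => norm_nonneg _) hiB
          (ae_of_all _ fun x => ?_)
        show ‖G x * (kop κ)^[m] g (x (b + 1))‖ ≤ (2 * Ch) ^ 2 * (2 * Cg * (A * ρ ^ m))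
        rw [Real.norm_eq_abs, abs_mul]
        exact mul_le_mul (hGb x) (hdec _) (abs_nonneg _) (by positivity)
    _ = (2 * Ch) ^ 2 * (2 * Cg * (A * ρ ^ m)) := by
        rw [integral_const, probReal_univ, smul_eq_mul, one_mul]
    _ = 8 * Ch ^ 2 * Cg * A * ρ ^ m := by ring

/-- **THE SQUARED BLOCK MARTINGALE DECORRELATES FROM EVERY LATER CENTRED OBSERVABLE, UNIFORMLY IN
THE BLOCK LENGTH.**  Envelope `(A, ρ)` (`0 ≤ A`, `0 ≤ ρ < 1`), `|h| ≤ C_h`, `|ḡ| ≤ C_g` measurable with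
`πḡ = 0`; for every `μ₀`, `s`, `n`, `m`:
`|E_{μ₀}[M_{s,n}² · ḡ(X_{s+n+m})]| ≤ (8 C_h² C_g A + 32 C_h² C_g A²/(1−ρ)) ρ^m/(1−ρ)`. -/
theorem abs_chain_blockMartingale_sq_mul_future_le_of_envelope
    (henv : ∀ (g : Ω → ℝ), Measurable g → ∀ (Cg : ℝ), (∀ x, |g x| ≤ Cg) →
      ∀ (t : ℕ) (x : Ω), |(kop κ)^[t] g x - ∫ y, g y ∂π| ≤ 2 * Cg * (A * ρ ^ t))
    (hA : 0 ≤ A) (hρ0 : 0 ≤ ρ) (hρ1 : ρ < 1)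
    {h : Ω → ℝ} (hh : Measurable h) {Ch : ℝ} (hCh : ∀ x, |h x| ≤ Ch)
    {g : Ω → ℝ} (hg : Measurable g) {Cg : ℝ} (hCg : ∀ x, |g x| ≤ Cg) (hg0 : ∫ y, g y ∂π = 0)
    (s : ℕ) : ∀ n m : ℕ,
    |∫ x, (∑ t ∈ Finset.range n, (h (x (s + t + 1)) - kop κ h (x (s + t)))) ^ 2 * g (x (s + n + m))
        ∂(Kernel.trajMeasure (X := fun _ : ℕ => Ω) μ₀
          (fun n : ℕ => κ.comap (fun h : (i : ↥(Finset.Iic n)) → Ω => h ⟨n, Finset.mem_Iic.2 le_rfl⟩)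
            (measurable_pi_apply _)))|
      ≤ (8 * Ch ^ 2 * Cg * A + 32 * Ch ^ 2 * Cg * A ^ 2 / (1 - ρ)) * ρ ^ m / (1 - ρ)
  | 0, m => by
    have h1ρ : 0 < 1 - ρ := sub_pos.2 hρ1
    have hCg0 : 0 ≤ Cg := (abs_nonneg _).trans (hCg (Classical.choice
      (nonempty_of_isProbabilityMeasure μ₀)))
    simp only [Finset.range_zero, Finset.sum_empty, ne_eq, OfNat.ofNat_ne_zero, not_false_eq_true,
      zero_pow, zero_mul, integral_zero, abs_zero]
    positivity
  | n + 1, m => by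
    set P := Kernel.trajMeasure (X := fun _ : ℕ => Ω) μ₀
        (fun n : ℕ => κ.comap (fun h : (i : ↥(Finset.Iic n)) → Ω => h ⟨n, Finset.mem_Iic.2 le_rfl⟩)
          (measurable_pi_apply _)) with hP
    have h1ρ : 0 < 1 - ρ := sub_pos.2 hρ1
    have hCh0 : 0 ≤ Ch := (abs_nonneg _).trans (hCh (Classical.choice
      (nonempty_of_isProbabilityMeasure μ₀)))
    have hCg0 : 0 ≤ Cg := (abs_nonneg _).trans (hCg (Classical.choice
      (nonempty_of_isProbabilityMeasure μ₀)))
    set c : ℝ := 8 * Ch ^ 2 * Cg * A + 32 * Ch ^ 2 * Cg * A ^ 2 / (1 - ρ) with hc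
    have hc0 : 0 ≤ c := by positivity
    -- induction hypothesis at distance `m + 1`
    have ih := abs_chain_blockMartingale_sq_mul_future_le_of_envelope henv hA hρ0 hρ1 hh hCh hg hCg
      hg0 s n (m + 1)
    rw [← hP] at ih
    -- notation
    set D : ℕ → (ℕ → Ω) → ℝ := fun t x => h (x (s + t + 1)) - kop κ h (x (s + t)) with hD
    set M : (ℕ → Ω) → ℝ := fun x => ∑ t ∈ Finset.range n, D t x with hM
    have hDm : ∀ t, Measurable (D t) := fun t =>
      (hh.comp (measurable_pi_apply _)).sub ((measurable_kop κ hh).comp (measurable_pi_apply _))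
    have hDb : ∀ t x, |D t x| ≤ 2 * Ch := fun t x =>
      (abs_sub _ _).trans (by linarith [hCh (x (s + t + 1)), abs_kop_le κ hCh (x (s + t))])
    have hMm : Measurable M := Finset.measurable_sum _ fun t _ => hDm t
    have hMb : ∀ x, |M x| ≤ n * (2 * Ch) := fun x => abs_blockMartingale_le κ hCh s n x
    have hgx : Measurable fun x : ℕ → Ω => g (x (s + (n + 1) + m)) := hg.comp (measurable_pi_apply _)
    -- the time of the observable, three spellings
    have et : s + (n + 1) + m = s + n + (m + 1) := by ring
    have et' : s + (n + 1) + m = s + n + 1 + m := by ring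
    -- expand `M_{n+1}² g = M_n² g + 2 M_n D_n g + D_n² g`
    have hsucc : ∀ x : ℕ → Ω, ∑ t ∈ Finset.range (n + 1), D t x = M x + D n x := fun x => by
      rw [Finset.sum_range_succ]
    have hiA : Integrable (fun x => M x ^ 2 * g (x (s + (n + 1) + m))) P :=
      integrable_of_bounded P ((hMm.pow_const 2).mul hgx) (C := (n * (2 * Ch)) ^ 2 * Cg) fun x => by
        rw [abs_mul, abs_pow]
        exact mul_le_mul (pow_le_pow_left₀ (abs_nonneg _) (hMb x) 2) (hCg _) (abs_nonneg _)
          (by positivity)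
    have hiBt : ∀ t, Integrable (fun x => D t x * D n x * g (x (s + (n + 1) + m))) P := fun t =>
      integrable_of_bounded P (((hDm t).mul (hDm n)).mul hgx) (C := 2 * Ch * (2 * Ch) * Cg) fun x => by
        rw [abs_mul, abs_mul]
        exact mul_le_mul (mul_le_mul (hDb t x) (hDb n x) (abs_nonneg _) (by positivity)) (hCg _)
          (abs_nonneg _) (by positivity)
    have hiB : Integrable (fun x => 2 * ∑ t ∈ Finset.range n, D t x * D n x * g (x (s + (n + 1) + m))) P :=
      (integrable_finsetSum _ fun t _ => hiBt t).const_mul 2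
    have hiC : Integrable (fun x => D n x ^ 2 * g (x (s + (n + 1) + m))) P :=
      integrable_of_bounded P (((hDm n).pow_const 2).mul hgx) (C := (2 * Ch) ^ 2 * Cg) fun x => by
        rw [abs_mul, abs_pow]
        exact mul_le_mul (pow_le_pow_left₀ (abs_nonneg _) (hDb n x) 2) (hCg _) (abs_nonneg _)
          (by positivity)
    have hexp : ∀ x : ℕ → Ω, (∑ t ∈ Finset.range (n + 1), D t x) ^ 2 * g (x (s + (n + 1) + m))
        = M x ^ 2 * g (x (s + (n + 1) + m))
          + 2 * ∑ t ∈ Finset.range n, D t x * D n x * g (x (s + (n + 1) + m))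
          + D n x ^ 2 * g (x (s + (n + 1) + m)) := by
      intro x
      rw [hsucc x, hM, Finset.mul_sum]
      have : ∑ t ∈ Finset.range n, 2 * (D t x * D n x * g (x (s + (n + 1) + m)))
          = 2 * ((∑ t ∈ Finset.range n, D t x) * D n x * g (x (s + (n + 1) + m))) := by
        rw [← Finset.mul_sum, Finset.sum_mul, Finset.sum_mul]
      rw [this]; ring
    have hiAB : Integrable (fun x => M x ^ 2 * g (x (s + (n + 1) + m))
        + 2 * ∑ t ∈ Finset.range n, D t x * D n x * g (x (s + (n + 1) + m))) P := hiA.add hiB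
    have hsplit : ∫ x, (∑ t ∈ Finset.range (n + 1), D t x) ^ 2 * g (x (s + (n + 1) + m)) ∂P
        = ∫ x, M x ^ 2 * g (x (s + (n + 1) + m)) ∂P
          + 2 * ∑ t ∈ Finset.range n, ∫ x, D t x * D n x * g (x (s + (n + 1) + m)) ∂P
          + ∫ x, D n x ^ 2 * g (x (s + (n + 1) + m)) ∂P := by
      rw [integral_congr_ae (ae_of_all _ hexp), integral_add hiAB hiC, integral_add hiA hiB,
        integral_const_mul, integral_finsetSum _ fun t _ => hiBt t]
    -- (1) the old square at distance `m + 1`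
    have hT1 : |∫ x, M x ^ 2 * g (x (s + (n + 1) + m)) ∂P| ≤ c * ρ ^ (m + 1) / (1 - ρ) := by
      have e : (fun x : ℕ → Ω => M x ^ 2 * g (x (s + (n + 1) + m)))
          = fun x => M x ^ 2 * g (x (s + n + (m + 1))) := by
        funext x; rw [et]
      rw [e]
      exact ih
    -- (2) the cross terms, two gaps each
    have hT2 : ∀ t ∈ Finset.range n, |∫ x, D t x * D n x * g (x (s + (n + 1) + m)) ∂P|
        ≤ 16 * Ch ^ 2 * Cg * A ^ 2 * ρ ^ m * ρ ^ (n - 1 - t) := by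
      intro t ht
      have htn := Finset.mem_range.1 ht
      obtain ⟨m', hm'⟩ := Nat.exists_eq_add_of_lt htn
      have hsub : n - 1 - t = m' := by omega
      have e1 : ∀ x : ℕ → Ω, D t x * D n x * g (x (s + (n + 1) + m))
          = (h (x (s + t + 1)) - kop κ h (x (s + t)))
            * (h (x (s + t + 1 + m' + 1)) - kop κ h (x (s + t + 1 + m')))
            * g (x (s + t + 1 + m' + 1 + m)) := by
        intro x
        have e2 : s + n + 1 = s + t + 1 + m' + 1 := by omega
        have e3 : s + n = s + t + 1 + m' := by omega
        have e4 : s + (n + 1) + m = s + t + 1 + m' + 1 + m := by omega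
        simp only [hD]
        rw [e2, e3, e4]
      rw [integral_congr_ae (ae_of_all _ e1), hsub]
      have h := abs_chain_increment_increment_future_le_of_envelope μ₀ henv (s + t) m' m hh hCh hg hCg
      rw [← hP] at h
      exact h
    have hT2s : |2 * ∑ t ∈ Finset.range n, ∫ x, D t x * D n x * g (x (s + (n + 1) + m)) ∂P|
        ≤ 32 * Ch ^ 2 * Cg * A ^ 2 * ρ ^ m / (1 - ρ) := by
      rw [abs_mul, abs_two]
      have hgeo : ∑ t ∈ Finset.range n, ρ ^ (n - 1 - t) ≤ 1 / (1 - ρ) := by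
        rw [Finset.sum_range_reflect (fun k => ρ ^ k) n, one_div]
        exact sum_le_hasSum _ (fun k _ => pow_nonneg hρ0 k) (hasSum_geometric_of_lt_one hρ0 hρ1)
      calc 2 * |∑ t ∈ Finset.range n, ∫ x, D t x * D n x * g (x (s + (n + 1) + m)) ∂P|
          ≤ 2 * ∑ t ∈ Finset.range n, |∫ x, D t x * D n x * g (x (s + (n + 1) + m)) ∂P| :=
            mul_le_mul_of_nonneg_left (Finset.abs_sum_le_sum_abs _ _) zero_le_two
        _ ≤ 2 * ∑ t ∈ Finset.range n, 16 * Ch ^ 2 * Cg * A ^ 2 * ρ ^ m * ρ ^ (n - 1 - t) :=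
            mul_le_mul_of_nonneg_left (Finset.sum_le_sum hT2) zero_le_two
        _ = 2 * (16 * Ch ^ 2 * Cg * A ^ 2 * ρ ^ m) * ∑ t ∈ Finset.range n, ρ ^ (n - 1 - t) := by
            rw [Finset.mul_sum, Finset.mul_sum]
            exact Finset.sum_congr rfl fun i _ => by ring
        _ ≤ 2 * (16 * Ch ^ 2 * Cg * A ^ 2 * ρ ^ m) * (1 / (1 - ρ)) :=
            mul_le_mul_of_nonneg_left hgeo (by positivity)
        _ = 32 * Ch ^ 2 * Cg * A ^ 2 * ρ ^ m / (1 - ρ) := by ring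
    -- (3) the new diagonal term
    have hT3 : |∫ x, D n x ^ 2 * g (x (s + (n + 1) + m)) ∂P| ≤ 8 * Ch ^ 2 * Cg * A * ρ ^ m := by
      have e : (fun x : ℕ → Ω => D n x ^ 2 * g (x (s + (n + 1) + m)))
          = fun x => (h (x (s + n + 1)) - kop κ h (x (s + n))) ^ 2 * g (x (s + n + 1 + m)) := by
        funext x; rw [et']
      rw [e]
      have h := abs_chain_incrementSq_future_le_of_envelope μ₀ henv (s + n) m hh hCh hg hCg hg0
      rw [← hP] at h
      exact h
    -- assemble: `c ρ^{m+1}/(1−ρ) + 32 C_h² C_g A² ρ^m/(1−ρ) + 8 C_h² C_g A ρ^m = c ρ^m/(1−ρ)`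
    rw [hsplit]
    calc |∫ x, M x ^ 2 * g (x (s + (n + 1) + m)) ∂P
          + 2 * ∑ t ∈ Finset.range n, ∫ x, D t x * D n x * g (x (s + (n + 1) + m)) ∂P
          + ∫ x, D n x ^ 2 * g (x (s + (n + 1) + m)) ∂P|
        ≤ |∫ x, M x ^ 2 * g (x (s + (n + 1) + m)) ∂P|
          + |2 * ∑ t ∈ Finset.range n, ∫ x, D t x * D n x * g (x (s + (n + 1) + m)) ∂P|
          + |∫ x, D n x ^ 2 * g (x (s + (n + 1) + m)) ∂P| :=
          (abs_add_le _ _).trans (add_le_add (abs_add_le _ _) le_rfl)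
      _ ≤ c * ρ ^ (m + 1) / (1 - ρ) + 32 * Ch ^ 2 * Cg * A ^ 2 * ρ ^ m / (1 - ρ)
          + 8 * Ch ^ 2 * Cg * A * ρ ^ m := add_le_add (add_le_add hT1 hT2s) hT3
      _ = c * ρ ^ m / (1 - ρ) := by
          rw [hc, pow_succ]
          field_simp
          ring

end Envelope

end Summit.Ventures.LatticeQCDFlow.Scoring

end

/-! ## Appendix (row 8, GEN-22): a later observable that is NOT centred — asymptotic independence
`E[M²_{s,n} g(X_{s+n+m})] − (πg)·E[M²_{s,n}] = O(ρ^m)` uniformly in `n`, `s` (via `ḡ = g − πg`). -/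

noncomputable section

namespace Summit.Ventures.LatticeQCDFlow.Scoring

open MeasureTheory ProbabilityTheory Filter Finset Preorder Literature.Probability.MarkovChains

variable {Ω : Type*} [MeasurableSpace Ω] {κ : Kernel Ω Ω} [IsMarkovKernel κ] {π : Measure Ω}
  [IsProbabilityMeasure π] {A ρ : ℝ} (μ₀ : Measure Ω) [IsProbabilityMeasure μ₀] in
/-- **ASYMPTOTIC INDEPENDENCE OF THE SQUARED BLOCK MARTINGALE FROM A LATER OBSERVABLE.**
Envelope `(A, ρ)` (`0 ≤ A`, `0 ≤ ρ < 1`), `π` a probability measure, `|h| ≤ C_h` and `|g| ≤ C_g`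
measurable (`g` NOT assumed centred); for every `μ₀`, `s`, `n`, `m`:
`|E_{μ₀}[M_{s,n}² g(X_{s+n+m})] − (∫ g dπ) · E_{μ₀}[M_{s,n}²]|`
`≤ (8 C_h² (2C_g) A + 32 C_h² (2C_g) A²/(1−ρ)) ρ^m/(1−ρ)`. -/
theorem abs_chain_blockMartingale_sq_mul_future_sub_le_of_envelope
    (henv : ∀ (g : Ω → ℝ), Measurable g → ∀ (Cg : ℝ), (∀ x, |g x| ≤ Cg) →
      ∀ (t : ℕ) (x : Ω), |(kop κ)^[t] g x - ∫ y, g y ∂π| ≤ 2 * Cg * (A * ρ ^ t))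
    (hA : 0 ≤ A) (hρ0 : 0 ≤ ρ) (hρ1 : ρ < 1)
    {h : Ω → ℝ} (hh : Measurable h) {Ch : ℝ} (hCh : ∀ x, |h x| ≤ Ch)
    {g : Ω → ℝ} (hg : Measurable g) {Cg : ℝ} (hCg : ∀ x, |g x| ≤ Cg) (s n m : ℕ) :
    |∫ x, (∑ t ∈ Finset.range n, (h (x (s + t + 1)) - kop κ h (x (s + t)))) ^ 2 * g (x (s + n + m))
        ∂(Kernel.trajMeasure (X := fun _ : ℕ => Ω) μ₀
          (fun n : ℕ => κ.comap (fun h : (i : ↥(Finset.Iic n)) → Ω => h ⟨n, Finset.mem_Iic.2 le_rfl⟩)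
            (measurable_pi_apply _)))
      - (∫ y, g y ∂π) * ∫ x, (∑ t ∈ Finset.range n, (h (x (s + t + 1)) - kop κ h (x (s + t)))) ^ 2
        ∂(Kernel.trajMeasure (X := fun _ : ℕ => Ω) μ₀
          (fun n : ℕ => κ.comap (fun h : (i : ↥(Finset.Iic n)) → Ω => h ⟨n, Finset.mem_Iic.2 le_rfl⟩)
            (measurable_pi_apply _)))|
      ≤ (8 * Ch ^ 2 * (2 * Cg) * A + 32 * Ch ^ 2 * (2 * Cg) * A ^ 2 / (1 - ρ)) * ρ ^ m / (1 - ρ) := by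
  set P := Kernel.trajMeasure (X := fun _ : ℕ => Ω) μ₀
      (fun n : ℕ => κ.comap (fun h : (i : ↥(Finset.Iic n)) → Ω => h ⟨n, Finset.mem_Iic.2 le_rfl⟩)
        (measurable_pi_apply _)) with hP
  set c : ℝ := ∫ y, g y ∂π with hc
  obtain ⟨hgb, hCgb, hgb0⟩ := centred_observable_bounds π hg hCg
  have key := abs_chain_blockMartingale_sq_mul_future_le_of_envelope μ₀ henv hA hρ0 hρ1 hh hCh hgb
    hCgb hgb0 s n m
  rw [← hP] at key
  set M : (ℕ → Ω) → ℝ := fun x => ∑ t ∈ Finset.range n, (h (x (s + t + 1)) - kop κ h (x (s + t)))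
    with hM
  have hMm : Measurable M := Finset.measurable_sum _ fun t _ =>
    (hh.comp (measurable_pi_apply _)).sub ((measurable_kop κ hh).comp (measurable_pi_apply _))
  have hM2b : ∀ x, |M x ^ 2| ≤ (n * (2 * Ch)) ^ 2 := fun x => by
    rw [abs_pow]; exact pow_le_pow_left₀ (abs_nonneg _) (abs_blockMartingale_le κ hCh s n x) 2
  have hgx : Measurable fun x : ℕ → Ω => g (x (s + n + m)) := hg.comp (measurable_pi_apply _)
  have hiM2 : Integrable (fun x => M x ^ 2) P :=
    integrable_of_bounded P (hMm.pow_const 2) (C := (n * (2 * Ch)) ^ 2) hM2b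
  have hiM2g : Integrable (fun x => M x ^ 2 * g (x (s + n + m))) P :=
    integrable_of_bounded P ((hMm.pow_const 2).mul hgx) (C := (n * (2 * Ch)) ^ 2 * Cg) fun x => by
      rw [abs_mul]; exact mul_le_mul (hM2b x) (hCg _) (abs_nonneg _) (by positivity)
  -- `E[M² ḡ] = E[M² g] − c E[M²]`
  have hsplit : ∫ x, M x ^ 2 * (g (x (s + n + m)) - c) ∂P
      = ∫ x, M x ^ 2 * g (x (s + n + m)) ∂P - c * ∫ x, M x ^ 2 ∂P := by
    simp_rw [mul_sub, integral_sub hiM2g (hiM2.mul_const c), integral_mul_const]; ring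
  have key' : |∫ x, M x ^ 2 * (g (x (s + n + m)) - c) ∂P|
      ≤ (8 * Ch ^ 2 * (2 * Cg) * A + 32 * Ch ^ 2 * (2 * Cg) * A ^ 2 / (1 - ρ)) * ρ ^ m / (1 - ρ) := by
    simpa only [hM] using key
  rw [hsplit] at key'
  simpa only [hM] using key'

end Summit.Ventures.LatticeQCDFlow.Scoring

end
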